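import Literature.AlgebraicGeometry.Motives.HodgeStructureExteriorAlgebraKunnethGysin
import Literature.AlgebraicGeometry.Motives.HodgeStructureExteriorPowerPrimitiveIrreducible
import HarnessLib

/-!
# Milne's dictionary `u ↦ ū`, `ū(x) = q_*(p^*x ∪ u)`, between `⋀(W₁ ⊕ W₂)` and `Hom(⋀W₁, ⋀W₂)`: it is a linear isomorphism, and
# `u` is fixed by `(γ₁, γ₂)` iff `ū` intertwines `⋀γ₁` and `⋀γ₂` (the mechanism of Prop. 5.7)

[topic AlgebraicGeometry/Motives]

Layer `Literature/AlgebraicGeometry/Motives`, lane `lit-hodgefound` (Track 2 foundations library; prover seat `lit-hodgefound-p34`,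
generation 32, row g32-#2). Sequel of row g32-#1 (`Motives/HodgeStructureExteriorAlgebraKunnethGysin`: `kunnethEquiv = Φ`,
`gysinSnd = q_*`, the product and projection formulas, Poincaré duality `IsSymplectic.nondegenerate_trace_mul`). TWO DEFINITIONS
WITH BODIES (`corrMap` = Milne's composite `u ↦ ū` LITERALLY, and its packaging `IsSymplectic.corrEquiv` as a linear equivalence)
+ THEOREMS; no named fact, no instance, no notation (net debt `0`).

THE SETTING is that of row g32-#1: `W₁`, `W₂` vector spaces over a field `K` of characteristic `0`, `ω₁ ∈ ⋀²W₁` symplectic of genus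
`g₁` (for the dictionary only `W₁` needs its "orientation" `τ_{ω₁} = η_A`), `Φ = kunnethEquiv K W₁ W₂ : ⋀W₁ ⊗ ⋀W₂ ≃ ⋀(W₁ × W₂)`,
`p^* = ⋀(inl)`, `q^* = ⋀(inr)`, `q_* = gysinSnd ω₁ g₁`. For abelian varieties `A`, `B`: `H•(A × B) = ⋀(H¹A ⊕ H¹B)` and
`Hom(H•A, H•B) = Hom(⋀H¹A, ⋀H¹B)`.

## Source, VERBATIM

J. S. Milne, *Lefschetz classes on abelian varieties*, Duke Math. J. **96** (1999) [Milne1999LefschetzClasses] (held text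
`paper:doi-10-1215-s0012-7094-99-09620-5`, p0026 = p. 664): "*Correspondences.* Let `X` and `Y` be smooth projective varieties over
`Ω`. The elements of `H^{2*}(X × Y)(*)` are called cohomological correspondences between `X` and `Y`. The map sending
`u ∈ H^{2s}(X × Y)(s)` to the composite `H^*(X) —p^*→ H^*(X × Y) —(v ↦ v ∪ u)→ H^{*+2s}(X × Y)(s) —q_*→ H^{*+2s−2d}(Y)(s − d)`,
`d = dim X`, is an isomorphism `u ↦ ū : H^*(X × Y) → Hom(H^*(X), H^{*+2s−2d}(Y)(s − d))`. […] PROPOSITION 5.7. Let `A` and `B` be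
abelian varieties over `Ω`. A cohomological correspondence `u` between `A` and `B` is Lefschetz if and only if `ū : H^*(A) → H^*(B)`
commutes with the actions of `L(A × B)`. […] *Proof.* The map `u ↦ ū` is bijective and commutes with the action of `L(A × B)`,
whence the first statement."; proof of Prop. 5.4 (p. 663): "using that the action of `α` commutes with cup-products (by definition)
and the action of `φ^*`, we find that `η_B(φ_*(αx) ∪ αy) = […] = η_B(φ_*(x) ∪ y)`. Therefore […] `α⁻¹φ_*(αx) = φ_*(x)`".
C. Voisin, *Hodge Theory and Complex Algebraic Geometry I* (2002) [VoisinHodgeI2002], §11.3.3 p. 285, (11.11): "`α̃(η) = ⟨η, β⟩_X γ`"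
for `α = β ⊗ γ` (here, with Milne's order of the cup product, `Φ(a ⊗ b)~(x) = η_A(x ∪ a) · b`).

## What is PROVED (and the two definitions)

* §1 **`corrMap ω₁ g₁ : ⋀(W₁ × W₂) →ₗ[K] (⋀W₁ →ₗ[K] ⋀W₂)`, `u ↦ ū := q_* ∘ (· ∪ u) ∘ p^*`** — DEFINED as Milne's composite
  (`corrMap_apply : ū x = q_*(p^*x ∪ u)` holds by `rfl`); **`corrMap_kunnethEquiv_tmul_apply : Φ(a ⊗ b)~(x) = τ_{ω₁}(x ∧ a) · b`**
  (Voisin's (11.11)); `corrMap_kunnethEquiv_one_tmul_apply` (`Φ(1 ⊗ b)~ = x ↦ τ(x) b`), `corrMap_map_inr_apply` (`(q^*b)~ = τ(·) b`).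
* §2 **"The map `u ↦ ū` is bijective" — `IsSymplectic.corrMap_bijective`** (`ω₁` symplectic: `ū ∘ Φ = dualTensorHom ∘ (θ ⊗ 1)` with
  `θ : ⋀W₁ ⥲ (⋀W₁)^∨`, `a ↦ τ(· ∧ a)`, the Poincaré-duality isomorphism of row g32-#1, and `(⋀W₁)^∨ ⊗ ⋀W₂ ⥲ Hom(⋀W₁, ⋀W₂)`);
  the packaging **`IsSymplectic.corrEquiv : ⋀(W₁ × W₂) ≃ₗ[K] (⋀W₁ →ₗ[K] ⋀W₂)`** (`corrEquiv_apply`, `corrMap_corrEquiv_symm` — the CLASS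
  `[T] := corrEquiv⁻¹ T ∈ ⋀(W₁ × W₂)` of an operator `T : ⋀W₁ → ⋀W₂` realises `T`), `IsSymplectic.corrMap_injective`,
  `IsSymplectic.corrMap_eq_zero_iff`.
* §3 **"… and commutes with the action of `L(A × B)`" — `IsSymplectic.corrMap_map_prodMap_apply`: `(⋀(f₁ × f₂) u)~(⋀f₁ x) =
  ⋀f₂ (ū x)`** for every `f₁ : W₁ → W₁` with `⋀f₁ ω₁ = ω₁` (so that `η_A ∘ ⋀f₁ = η_A`, the ingredient of Prop. 5.4's proof) and every
  `f₂ : W₂ → W₂'` (naturality of `Φ`, row g32-#1); hence for AUTOMORPHISMS `f₁`: **`IsSymplectic.map_prodMap_eq_self_iff`: `⋀(f₁ × f₂) u = u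
  ↔ ⋀f₂ ∘ ū = ū ∘ ⋀f₁`** — "whence the first statement" of Prop. 5.7 (`u` is fixed by `(γ₁, γ₂)` iff `ū` commutes with the actions);
  and in class form **`IsSymplectic.map_prodMap_corrEquiv_symm`: `⋀(f₁ × f₂) [T] = [⋀f₂ ∘ T ∘ ⋀f₁⁻¹]`**,
  **`IsSymplectic.map_prodMap_corrEquiv_symm_eq_self_iff`: `⋀(f₁ × f₂) [T] = [T] ↔ ⋀f₂ ∘ T = T ∘ ⋀f₁`**.
  (`map_equiv_surjective`, `map_equiv_injective`, `map_equiv_symm_apply`: `⋀` of a linear isomorphism is an isomorphism.)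

TWIN NOTICE (RULING 29 bis): the torus-forms twin of the dictionary is `corrMapT` / `corrClass` of
`Geometry/Kaehler/ComplexTorusLefschetzAlgebraCorrespondences{,AnyBasis}` and `tensorToHomMap` of
`Geometry/Kaehler/ComplexTorusKunnethHomHodgeStructure`, the Betti-model twin `corrAction` of `HodgeTheory/CorrespondenceAction`; the
degree-2 mixed piece on the present carrier is `Polarization.tensorToHom` of `Motives/HodgeStructureDivisorClassesMixedHom` (with the
contraction in the FIRST variable); none is imported or restated.

## References

* [Milne1999LefschetzClasses] J. S. Milne, *Lefschetz classes on abelian varieties*, Duke Math. J. 96 (1999), §5 pp. 662–664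
  (φ_*, projection formula, Prop. 5.4, correspondences `u ↦ ū`, Prop. 5.7).
* [VoisinHodgeI2002] C. Voisin, *Hodge Theory and Complex Algebraic Geometry I* (2002), §11.3.3 Thm. 11.38, (11.11), Lemma 11.41.
* [BourbakiAlgebraI1989] N. Bourbaki, *Algebra I, Chapters 1–3* (1989), Ch. II §4 no. 2 (`M^* ⊗ N → Hom(M, N)`), Ch. III §7 no. 7
  Prop. 10 and Remark, §11 no. 11.
-/

noncomputable section

open scoped TensorProduct

namespace Literature.AlgebraicGeometry.Motives

namespace ExteriorLefschetz

open Literature.Algebra.Lie ExteriorAlgebra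
open Literature.LinearAlgebra.Alternating (map_coe_mem_exteriorPower extGrading)

variable {K : Type*} [Field K] [CharZero K] {W₁ W₂ : Type*} [AddCommGroup W₁] [Module K W₁] [AddCommGroup W₂] [Module K W₂]
  {ω₁ : ExteriorAlgebra K W₁} {g₁ : ℕ}

/-! ## §1 Milne's composite `u ↦ ū = q_* ∘ (· ∪ u) ∘ p^*` -/

variable (ω₁ g₁) in
/-- **Milne's dictionary `u ↦ ū : H•(A × B) → Hom(H•A, H•B)`, `ū := q_* ∘ (v ↦ v ∪ u) ∘ p^*`**, on `⋀(W₁ × W₂)` with `p^* = ⋀(inl)`,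
`q_* = gysinSnd ω₁ g₁` (the Gysin map of the second projection, "integration along `W₁`" for the orientation `τ_{ω₁}`): the linear map
`u ↦ (x ↦ q_*(p^*x ∧ u))`. [cite: Milne1999LefschetzClasses, §5 p. 664 ("The map sending u […] to the composite […] u ↦ ū")] -/
def corrMap : ExteriorAlgebra K (W₁ × W₂) →ₗ[K] (ExteriorAlgebra K W₁ →ₗ[K] ExteriorAlgebra K W₂) where
  toFun u := gysinSnd ω₁ g₁ ∘ₗ (LinearMap.mul K (ExteriorAlgebra K (W₁ × W₂))).flip u ∘ₗ
    (ExteriorAlgebra.map (LinearMap.inl K W₁ W₂)).toLinearMap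
  map_add' u v := by rw [map_add, LinearMap.add_comp, LinearMap.comp_add]
  map_smul' c u := by rw [map_smul, LinearMap.smul_comp, LinearMap.comp_smul, RingHom.id_apply]

/-- **`ū(x) = q_*(p^*x ∪ u)`** (definitional). [cite: Milne1999LefschetzClasses, §5 p. 664] -/
@[simp]
theorem corrMap_apply (u : ExteriorAlgebra K (W₁ × W₂)) (x : ExteriorAlgebra K W₁) :
    corrMap ω₁ g₁ u x = gysinSnd ω₁ g₁ (ExteriorAlgebra.map (LinearMap.inl K W₁ W₂) x * u) :=
  rfl

/-- **Voisin's (11.11) in Milne's convention: `Φ(a ⊗ b)~(x) = τ_{ω₁}(x ∧ a) · b`** (`p^*x ∪ p^*a ∪ q^*b = p^*(x ∧ a) ∪ q^*b` and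
`q_*(p^*c ∪ q^*b) = τ(c) b`). [cite: VoisinHodgeI2002, §11.3.3 (11.11)] [cite: Milne1999LefschetzClasses, §5 p. 664] -/
theorem corrMap_kunnethEquiv_tmul_apply (a x : ExteriorAlgebra K W₁) (b : ExteriorAlgebra K W₂) :
    corrMap ω₁ g₁ (kunnethEquiv K W₁ W₂ (a ⊗ₜ[K] b)) x = trace ω₁ g₁ (x * a) • b := by
  rw [corrMap_apply, kunnethEquiv_tmul, ← mul_assoc, ← map_mul, gysinSnd_map_inl_mul_map_inr]

/-- `Φ(1 ⊗ b)~(x) = τ_{ω₁}(x) · b` (the correspondence `q^*b`). [cite: Milne1999LefschetzClasses, §5 p. 664] -/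
theorem corrMap_kunnethEquiv_one_tmul_apply (x : ExteriorAlgebra K W₁) (b : ExteriorAlgebra K W₂) :
    corrMap ω₁ g₁ (kunnethEquiv K W₁ W₂ (1 ⊗ₜ[K] b)) x = trace ω₁ g₁ x • b := by
  rw [corrMap_kunnethEquiv_tmul_apply, mul_one]

/-- `(q^*b)~(x) = τ_{ω₁}(x) · b`. [cite: Milne1999LefschetzClasses, §5 p. 664] -/
theorem corrMap_map_inr_apply (x : ExteriorAlgebra K W₁) (b : ExteriorAlgebra K W₂) :
    corrMap ω₁ g₁ (ExteriorAlgebra.map (LinearMap.inr K W₁ W₂) b) x = trace ω₁ g₁ x • b := by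
  rw [← corrMap_kunnethEquiv_one_tmul_apply, kunnethEquiv_tmul, map_one, one_mul]

/-! ## §2 "The map `u ↦ ū` is bijective" -/

/-- **"The map `u ↦ ū` is bijective"** (`ω₁` symplectic of genus `g₁`): precomposed with the Künneth isomorphism `Φ`, `u ↦ ū` is the
composite of `θ ⊗ 1 : ⋀W₁ ⊗ ⋀W₂ ⥲ (⋀W₁)^∨ ⊗ ⋀W₂`, `θ(a) = τ_{ω₁}(· ∧ a)` (an isomorphism by the Poincaré duality of `⋀W₁`, row g32-#1
`IsSymplectic.nondegenerate_trace_mul`), with the canonical isomorphism `(⋀W₁)^∨ ⊗ ⋀W₂ ⥲ Hom(⋀W₁, ⋀W₂)` (`⋀W₁` finite-dimensional).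
[cite: Milne1999LefschetzClasses, §5 p. 664 ("is an isomorphism"; proof of Prop. 5.7: "The map u ↦ ū is bijective")]
[cite: BourbakiAlgebraI1989, Ch. II §4 no. 2] -/
theorem IsSymplectic.corrMap_bijective (hω₁ : IsSymplectic ω₁ g₁) :
    Function.Bijective (corrMap (W₂ := W₂) ω₁ g₁) := by
  haveI := hω₁.finiteDimensional_exteriorAlgebra
  have hB : ((LinearMap.mul K (ExteriorAlgebra K W₁)).compr₂ (trace ω₁ g₁)).flip.Nondegenerate :=
    LinearMap.BilinForm.nondegenerate_flip_iff.2 hω₁.nondegenerate_trace_mul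
  let e : ExteriorAlgebra K (W₁ × W₂) ≃ₗ[K] (ExteriorAlgebra K W₁ →ₗ[K] ExteriorAlgebra K W₂) :=
    (kunnethEquiv K W₁ W₂).symm ≪≫ₗ (LinearEquiv.rTensor (ExteriorAlgebra K W₂) (LinearMap.BilinForm.toDual _ hB)) ≪≫ₗ
      dualTensorHomEquiv K (ExteriorAlgebra K W₁) (ExteriorAlgebra K W₂)
  suffices h : corrMap (W₂ := W₂) ω₁ g₁ = e.toLinearMap by rw [h]; exact e.bijective
  refine LinearMap.ext fun u ↦ ?_
  obtain ⟨t, rfl⟩ := (kunnethEquiv K W₁ W₂).surjective u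
  induction t using TensorProduct.induction_on with
  | zero => simp only [map_zero]
  | add a b ha hb => simp only [map_add, ha, hb]
  | tmul a b =>
    refine LinearMap.ext fun x ↦ ?_
    rw [corrMap_kunnethEquiv_tmul_apply]
    simp only [e, LinearEquiv.coe_coe, LinearEquiv.trans_apply, LinearEquiv.symm_apply_apply, LinearEquiv.rTensor_tmul,
      dualTensorHomEquiv, dualTensorHomEquivOfBasis_apply, dualTensorHom_apply, LinearMap.BilinForm.toDual_def, LinearMap.flip_apply,
      LinearMap.compr₂_apply, LinearMap.mul_apply']

/-- **The dictionary as a linear equivalence `⋀(W₁ × W₂) ≃ Hom(⋀W₁, ⋀W₂)`** (`ω₁` symplectic); its inverse sends an operator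
`T : ⋀W₁ → ⋀W₂` to ITS CLASS `[T] ∈ ⋀(W₁ × W₂)`, the unique correspondence realising `T`.
[cite: Milne1999LefschetzClasses, §5 p. 664 ("is an isomorphism u ↦ ū")] -/
def IsSymplectic.corrEquiv (hω₁ : IsSymplectic ω₁ g₁) :
    ExteriorAlgebra K (W₁ × W₂) ≃ₗ[K] (ExteriorAlgebra K W₁ →ₗ[K] ExteriorAlgebra K W₂) :=
  LinearEquiv.ofBijective (corrMap ω₁ g₁) hω₁.corrMap_bijective

/-- `corrEquiv u = ū`. [cite: Milne1999LefschetzClasses, §5 p. 664] -/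
@[simp]
theorem IsSymplectic.corrEquiv_apply (hω₁ : IsSymplectic ω₁ g₁) (u : ExteriorAlgebra K (W₁ × W₂)) :
    hω₁.corrEquiv (W₂ := W₂) u = corrMap ω₁ g₁ u :=
  rfl

/-- **The class `[T] = corrEquiv⁻¹ T` realises `T`: `[T]~ = T`.** [cite: Milne1999LefschetzClasses, §5 p. 664] -/
@[simp]
theorem IsSymplectic.corrMap_corrEquiv_symm (hω₁ : IsSymplectic ω₁ g₁) (T : ExteriorAlgebra K W₁ →ₗ[K] ExteriorAlgebra K W₂) :
    corrMap ω₁ g₁ (hω₁.corrEquiv.symm T) = T :=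
  hω₁.corrEquiv.apply_symm_apply T

/-- `corrEquiv⁻¹ ū = u`. [cite: Milne1999LefschetzClasses, §5 p. 664] -/
@[simp]
theorem IsSymplectic.corrEquiv_symm_corrMap (hω₁ : IsSymplectic ω₁ g₁) (u : ExteriorAlgebra K (W₁ × W₂)) :
    hω₁.corrEquiv.symm (corrMap (W₂ := W₂) ω₁ g₁ u) = u :=
  hω₁.corrEquiv.symm_apply_apply u

/-- `u ↦ ū` is injective: a correspondence is determined by its action. [cite: Milne1999LefschetzClasses, §5 p. 664] -/
theorem IsSymplectic.corrMap_injective (hω₁ : IsSymplectic ω₁ g₁) : Function.Injective (corrMap (W₂ := W₂) ω₁ g₁) :=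
  hω₁.corrMap_bijective.1

/-- `ū = 0 ↔ u = 0`. [cite: Milne1999LefschetzClasses, §5 p. 664] -/
theorem IsSymplectic.corrMap_eq_zero_iff (hω₁ : IsSymplectic ω₁ g₁) {u : ExteriorAlgebra K (W₁ × W₂)} :
    corrMap (W₂ := W₂) ω₁ g₁ u = 0 ↔ u = 0 := by
  rw [← (corrMap (W₂ := W₂) ω₁ g₁).map_zero]
  exact hω₁.corrMap_injective.eq_iff

/-! ## §3 "… and commutes with the action of `L(A × B)`": equivariance, and invariance of `u` ⟺ `ū` intertwines -/

omit [CharZero K] in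
/-- `⋀f (⋀f⁻¹ y) = y` for a linear isomorphism `f : W ≃ W'` (`⋀f ∘ ⋀f⁻¹ = ⋀(f ∘ f⁻¹) = id`).
[cite: BourbakiAlgebraI1989, Ch. III §7 no. 2 (functoriality of ⋀)] -/
theorem map_equiv_symm_apply {W W' : Type*} [AddCommGroup W] [Module K W] [AddCommGroup W'] [Module K W'] (f : W ≃ₗ[K] W')
    (y : ExteriorAlgebra K W') :
    ExteriorAlgebra.map (f : W →ₗ[K] W') (ExteriorAlgebra.map (f.symm : W' →ₗ[K] W) y) = y := by
  rw [← AlgHom.comp_apply, map_comp_map, show (f : W →ₗ[K] W') ∘ₗ (f.symm : W' →ₗ[K] W) = LinearMap.id from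
    LinearMap.ext fun v ↦ by simp, map_id, AlgHom.id_apply]

omit [CharZero K] in
/-- `⋀f⁻¹ (⋀f x) = x` for a linear isomorphism `f : W ≃ W'`. [cite: BourbakiAlgebraI1989, Ch. III §7 no. 2] -/
theorem map_equiv_symm_apply' {W W' : Type*} [AddCommGroup W] [Module K W] [AddCommGroup W'] [Module K W'] (f : W ≃ₗ[K] W')
    (x : ExteriorAlgebra K W) :
    ExteriorAlgebra.map (f.symm : W' →ₗ[K] W) (ExteriorAlgebra.map (f : W →ₗ[K] W') x) = x := by
  simpa using map_equiv_symm_apply f.symm x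

omit [CharZero K] in
/-- `⋀f` is surjective for a linear isomorphism `f : W ≃ W'`. [cite: BourbakiAlgebraI1989, Ch. III §7 no. 2] -/
theorem map_equiv_surjective {W W' : Type*} [AddCommGroup W] [Module K W] [AddCommGroup W'] [Module K W'] (f : W ≃ₗ[K] W') :
    Function.Surjective (ExteriorAlgebra.map (f : W →ₗ[K] W')) := fun y ↦
  ⟨ExteriorAlgebra.map (f.symm : W' →ₗ[K] W) y, map_equiv_symm_apply f y⟩

omit [CharZero K] in
/-- `⋀f` is injective for a linear isomorphism `f : W ≃ W'`. [cite: BourbakiAlgebraI1989, Ch. III §7 no. 2] -/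
theorem map_equiv_injective {W W' : Type*} [AddCommGroup W] [Module K W] [AddCommGroup W'] [Module K W'] (f : W ≃ₗ[K] W') :
    Function.Injective (ExteriorAlgebra.map (f : W →ₗ[K] W')) :=
  Function.LeftInverse.injective (map_equiv_symm_apply' f)

/-- **EQUIVARIANCE of `u ↦ ū`: `(⋀(f₁ × f₂) u)~(⋀f₁ x) = ⋀f₂ (ū x)`** for every `f₁ : W₁ → W₁` fixing `ω₁` (so `τ_{ω₁} ∘ ⋀f₁ = τ_{ω₁}`:
"the action of `α` commutes with cup-products […] `η_B(φ_*(αx) ∪ αy) = η_B(φ_*(x) ∪ y)`") and every `f₂ : W₂ → W₂'`; on `u = Φ(a ⊗ b)`: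
`τ(⋀f₁ x ∧ ⋀f₁ a) ⋀f₂ b = τ(x ∧ a) ⋀f₂ b`. [cite: Milne1999LefschetzClasses, §5 proof of Prop. 5.4 (p. 663) and of Prop. 5.7 (p. 664)] -/
theorem IsSymplectic.corrMap_map_prodMap_apply (hω₁ : IsSymplectic ω₁ g₁) {W₂' : Type*} [AddCommGroup W₂'] [Module K W₂']
    {f₁ : W₁ →ₗ[K] W₁} (hf₁ : ExteriorAlgebra.map f₁ ω₁ = ω₁) (f₂ : W₂ →ₗ[K] W₂') (u : ExteriorAlgebra K (W₁ × W₂))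
    (x : ExteriorAlgebra K W₁) :
    corrMap ω₁ g₁ (ExteriorAlgebra.map (f₁.prodMap f₂) u) (ExteriorAlgebra.map f₁ x) = ExteriorAlgebra.map f₂ (corrMap ω₁ g₁ u x) := by
  obtain ⟨t, rfl⟩ := (kunnethEquiv K W₁ W₂).surjective u
  induction t using TensorProduct.induction_on with
  | zero => simp only [map_zero, LinearMap.zero_apply]
  | add a b ha hb => simp only [map_add, LinearMap.add_apply, ha, hb]
  | tmul a b =>
    rw [map_prodMap_kunnethEquiv, TensorProduct.map_tmul, AlgHom.toLinearMap_apply, AlgHom.toLinearMap_apply,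
      corrMap_kunnethEquiv_tmul_apply, corrMap_kunnethEquiv_tmul_apply, ← map_mul, hω₁.trace_map f₁ hf₁, map_smul]

/-- The same as an identity of linear maps: **`(⋀(f₁ × f₂) u)~ ∘ ⋀f₁ = ⋀f₂ ∘ ū`**. [cite: Milne1999LefschetzClasses, §5 proof of Prop. 5.7 (p. 664)] -/
theorem IsSymplectic.corrMap_map_prodMap_comp (hω₁ : IsSymplectic ω₁ g₁) {W₂' : Type*} [AddCommGroup W₂'] [Module K W₂']
    {f₁ : W₁ →ₗ[K] W₁} (hf₁ : ExteriorAlgebra.map f₁ ω₁ = ω₁) (f₂ : W₂ →ₗ[K] W₂') (u : ExteriorAlgebra K (W₁ × W₂)) :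
    corrMap ω₁ g₁ (ExteriorAlgebra.map (f₁.prodMap f₂) u) ∘ₗ (ExteriorAlgebra.map f₁).toLinearMap =
      (ExteriorAlgebra.map f₂).toLinearMap ∘ₗ corrMap ω₁ g₁ u :=
  LinearMap.ext fun x ↦ hω₁.corrMap_map_prodMap_apply hf₁ f₂ u x

/-- **PROP. 5.7, THE MECHANISM ("whence the first statement"): for an automorphism `f₁` of `W₁` fixing `ω₁` and any `f₂ : W₂ → W₂`,
`⋀(f₁ × f₂) u = u ↔ ⋀f₂ ∘ ū = ū ∘ ⋀f₁`** — a correspondence is fixed by `(f₁, f₂)` iff its realisation commutes with the actions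
(`u ↦ ū` is injective and equivariant, `⋀f₁` is surjective). [cite: Milne1999LefschetzClasses, §5 Prop. 5.7 and its proof (p. 664)] -/
theorem IsSymplectic.map_prodMap_eq_self_iff (hω₁ : IsSymplectic ω₁ g₁) {f₁ : W₁ ≃ₗ[K] W₁}
    (hf₁ : ExteriorAlgebra.map (f₁ : W₁ →ₗ[K] W₁) ω₁ = ω₁) (f₂ : W₂ →ₗ[K] W₂) (u : ExteriorAlgebra K (W₁ × W₂)) :
    ExteriorAlgebra.map ((f₁ : W₁ →ₗ[K] W₁).prodMap f₂) u = u ↔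
      (ExteriorAlgebra.map f₂).toLinearMap ∘ₗ corrMap ω₁ g₁ u = corrMap ω₁ g₁ u ∘ₗ (ExteriorAlgebra.map (f₁ : W₁ →ₗ[K] W₁)).toLinearMap := by
  have key := hω₁.corrMap_map_prodMap_comp hf₁ f₂ u
  refine ⟨fun h ↦ ?_, fun h ↦ ?_⟩
  · rw [h] at key
    exact key.symm
  · apply hω₁.corrMap_injective
    refine LinearMap.ext fun x ↦ ?_
    obtain ⟨y, rfl⟩ := map_equiv_surjective f₁ x
    have h1 := LinearMap.congr_fun key y
    have h2 := LinearMap.congr_fun h y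
    simp only [LinearMap.comp_apply, AlgHom.toLinearMap_apply] at h1 h2
    rw [h1, h2]

/-- **The class of a conjugate: `⋀(f₁ × f₂) [T] = [⋀f₂ ∘ T ∘ ⋀f₁⁻¹]`** for an automorphism `f₁` of `W₁` fixing `ω₁` and any
`f₂ : W₂ → W₂` (`[T] = corrEquiv⁻¹ T`). [cite: Milne1999LefschetzClasses, §5 proof of Prop. 5.7 (p. 664, "commutes with the action of L(A × B)")] -/
theorem IsSymplectic.map_prodMap_corrEquiv_symm (hω₁ : IsSymplectic ω₁ g₁) {f₁ : W₁ ≃ₗ[K] W₁}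
    (hf₁ : ExteriorAlgebra.map (f₁ : W₁ →ₗ[K] W₁) ω₁ = ω₁) (f₂ : W₂ →ₗ[K] W₂) (T : ExteriorAlgebra K W₁ →ₗ[K] ExteriorAlgebra K W₂) :
    ExteriorAlgebra.map ((f₁ : W₁ →ₗ[K] W₁).prodMap f₂) (hω₁.corrEquiv.symm T) =
      hω₁.corrEquiv.symm ((ExteriorAlgebra.map f₂).toLinearMap ∘ₗ T ∘ₗ (ExteriorAlgebra.map (f₁.symm : W₁ →ₗ[K] W₁)).toLinearMap) := by
  apply hω₁.corrMap_injective
  rw [hω₁.corrMap_corrEquiv_symm]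
  refine LinearMap.ext fun x ↦ ?_
  obtain ⟨y, rfl⟩ := map_equiv_surjective f₁ x
  rw [hω₁.corrMap_map_prodMap_apply hf₁ f₂, hω₁.corrMap_corrEquiv_symm, LinearMap.comp_apply, LinearMap.comp_apply,
    AlgHom.toLinearMap_apply, AlgHom.toLinearMap_apply, map_equiv_symm_apply']

/-- **`⋀(f₁ × f₂) [T] = [T] ↔ ⋀f₂ ∘ T = T ∘ ⋀f₁`**: the class of an operator is fixed by `(f₁, f₂)` iff the operator intertwines —
Prop. 5.7's mechanism read on classes of operators (as used for `Λ`, `ᶜΛ`, `∗` in Thm. 5.9). [cite: Milne1999LefschetzClasses, §5 Prop. 5.7, Thm. 5.9 (pp. 664–665)] -/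
theorem IsSymplectic.map_prodMap_corrEquiv_symm_eq_self_iff (hω₁ : IsSymplectic ω₁ g₁) {f₁ : W₁ ≃ₗ[K] W₁}
    (hf₁ : ExteriorAlgebra.map (f₁ : W₁ →ₗ[K] W₁) ω₁ = ω₁) (f₂ : W₂ →ₗ[K] W₂) (T : ExteriorAlgebra K W₁ →ₗ[K] ExteriorAlgebra K W₂) :
    ExteriorAlgebra.map ((f₁ : W₁ →ₗ[K] W₁).prodMap f₂) (hω₁.corrEquiv.symm T) = hω₁.corrEquiv.symm T ↔
      (ExteriorAlgebra.map f₂).toLinearMap ∘ₗ T = T ∘ₗ (ExteriorAlgebra.map (f₁ : W₁ →ₗ[K] W₁)).toLinearMap := by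
  rw [hω₁.map_prodMap_eq_self_iff hf₁, hω₁.corrMap_corrEquiv_symm]

end ExteriorLefschetz

end Literature.AlgebraicGeometry.Motives
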